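import Literature.MathematicalPhysics.QuantumFieldTheory.OSAxiomsProofs
import Literature.MathematicalPhysics.QuantumLattice.RandomFieldExtProofs
import Literature.MathematicalPhysics.QuantumLattice.FreeCovarianceLinActProofs
import Mathlib.Probability.Distributions.Gaussian.HasGaussianLaw.Independence
import Mathlib.Analysis.SpecialFunctions.ExpDeriv
import HarnessLib

/-!
# The free field: complex Gaussian integrals, OS0 (analyticity) and OS2 (invariance)

First instalment of the discharge of the named fact
`Literature.MathematicalPhysics.QuantumLattice.IsFreeField.isOSMeasure`
(`Literature/MathematicalPhysics/QuantumFieldTheory/OSAxioms.lean`, constructive-qft.S07: the free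
Euclidean field of mass `m > 0` satisfies the Osterwalder–Schrader axioms OS0–OS4 of Glimm–Jaffe
§6.1). A free field is a law `μ` on `𝒮'(E) = FieldConfig E` with `IsFreeField m μ`: a centred
Gaussian Borel probability measure whose generating functional is `S{f} = exp (-½ C_m(f, f))`,
`C_m = (-Δ + m²)⁻¹` (Glimm–Jaffe (6.2.2), (6.2.10)). This file proves, for every such `μ` (any
real `m`, over any finite-dimensional real inner product space `E`):

* `IsFreeField.integral_cexp_eval_sub_eval` — the **complex Gaussian integral**
  `∫ exp (i ω(g) - ω(k)) dμ = exp (-½ (C_m(g,g) - C_m(k,k)) - i C_m(g,k))`, i.e. (6.2.2) at the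
  complex test function `g + ik` (`IsFreeField.genFunctionalC_eq` restates it for the prelude's
  `genFunctionalC`);
* `IsFreeField.integral_cexp_sum_eq` — `∫ exp (i ∑ zᵢ ω(fᵢ)) dμ = exp (-½ ∑ zᵢ zⱼ C_m(fᵢ, fⱼ))`
  for `z ∈ ℂⁿ`, and hence **OS0** `IsFreeField.isOS0Analytic` (exponential moments and
  entire analyticity of `z ↦ S{∑ zⱼ fⱼ}`, Glimm–Jaffe §6.1 p. 89);
* **OS2** `IsFreeField.isOS2Invariant` — Euclidean invariance `γ_* μ = μ` (Glimm–Jaffe §6.1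
  p. 90; §6.2 p. 99 "`dφ_C` and `S` satisfy ... Euclidean invariance if and only if `C` does").

No definition or statement of the tree is changed; no new definition is introduced.

## Proofs

* Complex Gaussian integral. Glimm–Jaffe obtain `S{f}` at complex `f` by analytic continuation
  of (6.2.2). We use an equivalent probabilistic computation which Mathlib supports directly:
  the pair `(ω(g'), ω(k))`, `g' = g - (B/D) k` with `B = C_m(g,k)`, `D = C_m(k,k)`, is jointly
  Gaussian (image of `μ` under a continuous linear map to `ℝ²`) with zero covariance (the
  two-point function is `C_m`, `IsFreeField.twoPoint_eq_holds`), hence independent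
  (`HasGaussianLaw.indepFun_of_covariance_eq_zero`); so
  `∫ e^{iω(g) - ω(k)} = ∫ e^{iω(g')} · ∫ e^{(iB/D - 1) ω(k)} = S{g'} · exp (D (iB/D - 1)²/2)` by
  (6.2.2) and the complex moment generating function of a real Gaussian
  (`complexMGF_gaussianReal`), which is the claimed value. (If `D = 0` then `ω(k) = 0` a.s.)
* OS0: with `g = ∑ (re zᵢ) fᵢ`, `k = ∑ (im zᵢ) fᵢ` one has `i ∑ zᵢ ω(fᵢ) = i ω(g) - ω(k)`, and the
  exponent is the polynomial `-½ ∑ zᵢ zⱼ C_m(fᵢ, fⱼ)` by bilinearity of the two-point function;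
  `exp ∘ polynomial` is entire (`AnalyticOnNhd.cexp`, `ContinuousLinearMap.analyticOnNhd`).
  Exponential moments: the law of `ω(f)` is `gaussianReal`, `integrable_exp_mul_gaussianReal`.
* OS2: `S_{γ_*μ}(f) = S_μ(γ⁻¹ f) = exp (-½ C_m(γ⁻¹f, γ⁻¹f)) = exp (-½ C_m(f, f)) = S_μ(f)` by
  Euclidean invariance of `C_m` (`freeCovarianceReal_euclidAct` over the discharged facts
  `freeCovariance_translate_holds`, `freeCovariance_linAct_holds`; Glimm–Jaffe §7.1), and a
  finite Borel measure on `𝒮'(E)` is determined by its generating functional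
  (`ext_of_genFunctional_holds`, Minlos uniqueness / Borel = cylinder σ-algebra).

## Mathlib

`ProbabilityTheory.HasGaussianLaw` (`.indepFun_of_covariance_eq_zero`, `.map_eq_gaussianReal`,
`.fst/.snd`), `isGaussian_map_of_measurable`, `PointwiseConvergenceCLM.evalCLM`,
`complexMGF_gaussianReal`, `integrable_exp_mul_gaussianReal`, `covariance_eq_sub`,
`variance_of_integral_eq_zero`, `ae_eq_integral_of_variance_eq_zero`,
`IndepFun.integral_fun_comp_mul_comp`, `AnalyticOnNhd.cexp`, `Finset.analyticOnNhd_fun_sum`.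

## References

* J. Glimm, A. Jaffe, *Quantum Physics: a functional integral point of view*, 2nd ed., Springer
  (1987), §6.1 pp. 89–90 (axioms OS0, OS2), §6.2 p. 99 (eqs. (6.2.1)–(6.2.4); invariance of
  `dφ_C` iff invariance of `C`), Thm 6.2.3 (entire analyticity of `S{f}` in complex `f`), §7.1
  (Euclidean invariance of `C = (-Δ + m²)⁻¹`). [GlimmJaffeQP1987]
* E. Nelson, *The free Markoff field*, J. Funct. Anal. 12 (1973) 211–227. [Nelson1973]
-/

open scoped SchwartzMap ComplexConjugate ProbabilityTheory
open MeasureTheory Complex ProbabilityTheory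

noncomputable section

namespace Literature.MathematicalPhysics.QuantumFieldTheory

open QuantumLattice

/-! ### Joint Gaussian law of evaluations -/

section GaussianLaw

variable {E : Type*} [NormedAddCommGroup E] [NormedSpace ℝ E]

/-- Under a centred Gaussian law on `𝒮'(E)` the pair of evaluations `ω ↦ (ω(g), ω(k))` is a
Gaussian random vector in `ℝ²` (it is the image of `μ` under a continuous linear map).
Glimm–Jaffe §6.2, (6.2.4) (finite-dimensional marginals of `dφ_C` are Gaussian). [folklore] -/
theorem _root_.Literature.MathematicalPhysics.QuantumLattice.IsGaussianField.hasGaussianLaw_eval_prod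
    {μ : Measure (FieldConfig E)} (hμ : IsGaussianField μ) (g k : 𝓢(E, ℝ)) :
    HasGaussianLaw (fun ω : FieldConfig E => (ω g, ω k)) μ := by
  obtain ⟨hG, -⟩ := hμ
  set L : FieldConfig E →L[ℝ] ℝ × ℝ :=
    (PointwiseConvergenceCLM.evalCLM (RingHom.id ℝ) ℝ g).prod
      (PointwiseConvergenceCLM.evalCLM (RingHom.id ℝ) ℝ k) with hL
  have hLm : Measurable L := L.continuous.measurable
  haveI : IsGaussian (μ.map L) := isGaussian_map_of_measurable hLm
  have h2 : (fun ω : FieldConfig E => (ω g, ω k)) = L := by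
    funext ω
    rfl
  rw [h2]
  exact IsGaussian.hasGaussianLaw

/-- Under a centred Gaussian law on `𝒮'(E)` every evaluation `ω ↦ ω(f)` is a real Gaussian random
variable. Glimm–Jaffe §6.2, (6.2.4). [folklore] -/
theorem _root_.Literature.MathematicalPhysics.QuantumLattice.IsGaussianField.hasGaussianLaw_eval
    {μ : Measure (FieldConfig E)} (hμ : IsGaussianField μ) (f : 𝓢(E, ℝ)) :
    HasGaussianLaw (fun ω : FieldConfig E => ω f) μ :=
  (hμ.hasGaussianLaw_eval_prod f f).fst

/-- A centred Gaussian law on `𝒮'(E)` has exponential moments: `ω ↦ exp (ω(f))` is integrable for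
every real test function `f` (the law of `ω(f)` is `gaussianReal 0 σ²`, whose moment generating
function is finite everywhere, Mathlib `integrable_exp_mul_gaussianReal`). Glimm–Jaffe §6.1 (OS0
for Gaussian measures: "`dμ` decays faster than any exponential"). [folklore] -/
theorem _root_.Literature.MathematicalPhysics.QuantumLattice.IsGaussianField.hasExponentialMoments
    {μ : Measure (FieldConfig E)} (hμ : IsGaussianField μ) : HasExponentialMoments μ := by
  intro f
  have hlaw := (hμ.hasGaussianLaw_eval f).map_eq_gaussianReal
  have hint := integrable_exp_mul_gaussianReal (μ := ∫ ω, ω f ∂μ)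
    (v := (Var[fun ω : FieldConfig E => ω f; μ]).toNNReal) 1
  rw [← hlaw] at hint
  have h := (integrable_map_measure (by fun_prop) (measurable_eval f).aemeasurable).1 hint
  simpa [Function.comp_def] using h

end GaussianLaw

/-! ### The complex Gaussian integral -/

section ComplexGaussian

variable {E : Type*} [NormedAddCommGroup E] [InnerProductSpace ℝ E] [FiniteDimensional ℝ E]
  [MeasurableSpace E] [BorelSpace E]

/-- **Complex Gaussian integral for the free field** (Glimm–Jaffe §6.1 OS0–OS1 for Gaussian
measures, §6.2 (6.2.2): `S{f} = e^{-⟨f, Cf⟩/2}` "is an entire analytic function of the complex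
variable `f` in the complex test function space", Thm 6.2.3). For real test functions `g, k`,
`∫ exp (i ω(g) - ω(k)) dμ_m(ω) = exp (-½ (C_m(g,g) - C_m(k,k)) - i C_m(g,k))`, i.e.
`S{g + ik} = exp (-½ C_m(g + ik, g + ik))` with `C_m` extended bilinearly. Proof (independence
instead of analytic continuation): with `D = C_m(k,k)`, `B = C_m(g,k)`, the evaluation
`ω(g - (B/D)k)` is uncorrelated with, hence (jointly Gaussian) independent of, `ω(k)`
(Mathlib `HasGaussianLaw.indepFun_of_covariance_eq_zero`); the integral factorises into
`S{g - (B/D)k}` and the complex moment generating function of the real Gaussian `ω(k)`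
(Mathlib `complexMGF_gaussianReal`). [cite: GlimmJaffeQP1987, §6.2 eq. (6.2.2)] -/
theorem _root_.Literature.MathematicalPhysics.QuantumLattice.IsFreeField.integral_cexp_eval_sub_eval
    {m : ℝ} {μ : Measure (FieldConfig E)} (h : IsFreeField m μ) (g k : 𝓢(E, ℝ)) :
    ∫ ω, cexp (I * (ω g : ℂ) - (ω k : ℂ)) ∂μ =
      cexp (-(1 / 2 : ℂ) * ((freeCovarianceReal m g g : ℂ) - freeCovarianceReal m k k) -
        I * freeCovarianceReal m g k) := by
  haveI : IsGaussian μ := h.1.1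
  have hGF : IsGaussianField μ := h.1
  have hk0 : ∫ ω, ω k ∂μ = 0 := (hGF.2 k).2
  have hV2 : MemLp (fun ω : FieldConfig E => ω k) 2 μ := hGF.memLp_eval k 2 (by simp)
  have hB : ∫ ω, ω g * ω k ∂μ = freeCovarianceReal m g k := IsFreeField.twoPoint_eq_holds h g k
  set D := freeCovarianceReal m k k with hDdef
  have hD : ∫ ω, (ω k) ^ 2 ∂μ = D := h.integral_sq_eq k
  have hVar : Var[fun ω : FieldConfig E => ω k; μ] = D := by
    rw [variance_of_integral_eq_zero hV2.aemeasurable hk0, hD]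
  by_cases hD0 : D = 0
  · -- degenerate case: `ω(k) = 0` almost surely
    have hae : ∀ᵐ ω ∂μ, ω k = 0 := by
      have h0 := ae_eq_integral_of_variance_eq_zero hV2 (hVar.trans hD0)
      filter_upwards [h0] with ω hω
      rw [hω]
      exact hk0
    have h1 : ∫ ω, cexp (I * (ω g : ℂ) - (ω k : ℂ)) ∂μ = ∫ ω, cexp (I * (ω g : ℂ)) ∂μ :=
      integral_congr_ae (by
        filter_upwards [hae] with ω hω
        simp [hω])
    have hB0 : freeCovarianceReal m g k = 0 := by
      rw [← hB]
      exact integral_eq_zero_of_ae (by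
        filter_upwards [hae] with ω hω
        simp [hω])
    have h2 := h.2 g
    simp only [genFunctional] at h2
    rw [h1, hB0, hD0, h2]
    congr 1
    push_cast
    ring
  · -- nondegenerate case: decorrelate `ω(g)` from `ω(k)`
    set B := freeCovarianceReal m g k with hBdef
    set A := freeCovarianceReal m g g with hAdef
    set c : ℝ := B / D with hc
    have hcD : c * D = B := div_mul_cancel₀ B hD0
    set g' : 𝓢(E, ℝ) := g - c • k with hg'
    have hW : ∀ ω : FieldConfig E, (ω g' : ℝ) = ω g - c * ω k := fun ω => by
      simp [hg', map_sub, map_smul, smul_eq_mul]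
    have hU2 : MemLp (fun ω : FieldConfig E => ω g) 2 μ := hGF.memLp_eval g 2 (by simp)
    have hW2 : MemLp (fun ω : FieldConfig E => ω g') 2 μ := hGF.memLp_eval g' 2 (by simp)
    have hA : ∫ ω, (ω g) ^ 2 ∂μ = A := h.integral_sq_eq g
    -- second moments of `ω(g')`
    have hWV : ∫ ω, ω g' * ω k ∂μ = 0 := by
      have e : (fun ω : FieldConfig E => ω g' * ω k) =
          fun ω => ω g * ω k - c * (ω k) ^ 2 := by
        funext ω
        rw [hW]
        ring
      rw [e, integral_sub (hGF.integrable_eval_mul g k) ((hGF.integrable_eval_sq k).const_mul c),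
        integral_const_mul, hB, hD]
      linarith [hcD]
    have hWW : ∫ ω, (ω g') ^ 2 ∂μ = A - 2 * c * B + c ^ 2 * D := by
      have e : (fun ω : FieldConfig E => (ω g') ^ 2) =
          fun ω => (ω g) ^ 2 - 2 * c * (ω g * ω k) + c ^ 2 * (ω k) ^ 2 := by
        funext ω
        rw [hW]
        ring
      have i5 : Integrable (fun ω : FieldConfig E => 2 * c * (ω g * ω k)) μ :=
        (hGF.integrable_eval_mul g k).const_mul _
      have i1 : Integrable (fun ω : FieldConfig E => (ω g) ^ 2 - 2 * c * (ω g * ω k)) μ :=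
        (hGF.integrable_eval_sq g).sub i5
      have i2 : Integrable (fun ω : FieldConfig E => c ^ 2 * (ω k) ^ 2) μ :=
        (hGF.integrable_eval_sq k).const_mul _
      rw [e, integral_add i1 i2, integral_sub (hGF.integrable_eval_sq g) i5,
        integral_const_mul, integral_const_mul, hA, hB, hD]
    -- independence of `ω(g')` and `ω(k)`
    have hpair : HasGaussianLaw (fun ω : FieldConfig E => (ω g', ω k)) μ :=
      hGF.hasGaussianLaw_eval_prod g' k
    have hcov : cov[fun ω : FieldConfig E => ω g', fun ω : FieldConfig E => ω k; μ] = 0 := by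
      rw [covariance_eq_sub hW2 hV2]
      have e1 : μ[(fun ω : FieldConfig E => ω g') * fun ω : FieldConfig E => ω k] =
          ∫ ω, ω g' * ω k ∂μ := rfl
      have e2 : μ[fun ω : FieldConfig E => ω k] = ∫ ω, ω k ∂μ := rfl
      rw [e1, e2, hWV, hk0, mul_zero, sub_zero]
    have hind : IndepFun (fun ω : FieldConfig E => ω g') (fun ω : FieldConfig E => ω k) μ :=
      hpair.indepFun_of_covariance_eq_zero hcov
    -- factorise the integrand and the integral
    have hfac : (fun ω : FieldConfig E => cexp (I * (ω g : ℂ) - (ω k : ℂ))) =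
        fun ω => cexp (I * (ω g' : ℂ)) * cexp ((I * c - 1) * (ω k : ℂ)) := by
      funext ω
      rw [← Complex.exp_add, hW]
      push_cast
      ring_nf
    rw [hfac, hind.integral_fun_comp_mul_comp (f := fun x : ℝ => cexp (I * (x : ℂ)))
      (g := fun x : ℝ => cexp ((I * c - 1) * (x : ℂ))) (measurable_eval g').aemeasurable
      (measurable_eval k).aemeasurable (by fun_prop) (by fun_prop)]
    -- first factor: the generating functional at the real test function `g'`
    have h1 : ∫ ω, cexp (I * (ω g' : ℂ)) ∂μ =
        cexp (-(1 / 2 : ℂ) * ((A - 2 * c * B + c ^ 2 * D : ℝ) : ℂ)) := by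
      have e := h.2 g'
      simp only [genFunctional] at e
      rw [e, ← h.integral_sq_eq g', hWW]
    -- second factor: the complex moment generating function of the Gaussian `ω(k)`
    have h2 : ∫ ω, cexp ((I * c - 1) * (ω k : ℂ)) ∂μ = cexp ((D : ℂ) * (I * c - 1) ^ 2 / 2) := by
      have e := complexMGF_gaussianReal hpair.snd.map_eq_gaussianReal (I * c - 1)
      simp only [complexMGF] at e
      rw [e]
      congr 1
      have e2 : μ[fun ω : FieldConfig E => ω k] = ∫ ω, ω k ∂μ := rfl
      rw [e2, hk0, hVar, Real.coe_toNNReal D (hDdef ▸ freeCovarianceReal_self_nonneg m k)]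
      push_cast
      ring
    rw [h1, h2, ← Complex.exp_add]
    congr 1
    have e : (c : ℂ) * D = B := by exact_mod_cast hcD
    push_cast
    linear_combination (-((c : ℂ) + I)) * e + ((D : ℂ) * (c : ℂ) ^ 2 / 2) * Complex.I_sq


/-- The complex generating functional of the free field at `f + i g`:
`S{f + ig} = ∫ exp (i ω(f) - ω(g)) dμ_m = exp (-½ (C_m(f,f) - C_m(g,g)) - i C_m(f,g))`
(Glimm–Jaffe §6.1 OS1 is stated on `S{f}` for complex `f`; (6.2.2)). [cite: GlimmJaffeQP1987, §6.2 eq. (6.2.2)] -/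
theorem _root_.Literature.MathematicalPhysics.QuantumLattice.IsFreeField.genFunctionalC_eq
    {m : ℝ} {μ : Measure (FieldConfig E)} (h : IsFreeField m μ) (f g : 𝓢(E, ℝ)) :
    genFunctionalC μ f g =
      cexp (-(1 / 2 : ℂ) * ((freeCovarianceReal m f f : ℂ) - freeCovarianceReal m g g) -
        I * freeCovarianceReal m f g) :=
  h.integral_cexp_eval_sub_eval f g

/-- Bilinear expansion of the free covariance over finite linear combinations of test functions,
`C_m(∑ aᵢ fᵢ, ∑ bⱼ fⱼ) = ∑ᵢⱼ aᵢ bⱼ C_m(fᵢ, fⱼ)`, obtained through the two-point function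
`C_m(f, g) = ∫ ω(f) ω(g) dμ_m` (`IsFreeField.twoPoint_eq_holds`) and linearity of `ω`; valid for
every `m` for which a free field exists. Glimm–Jaffe §6.2, (6.2.1). [folklore] -/
theorem _root_.Literature.MathematicalPhysics.QuantumLattice.IsFreeField.freeCovarianceReal_sum_smul
    {m : ℝ} {μ : Measure (FieldConfig E)} (h : IsFreeField m μ) {n : ℕ}
    (f : Fin n → 𝓢(E, ℝ)) (a b : Fin n → ℝ) :
    freeCovarianceReal m (∑ i, a i • f i) (∑ j, b j • f j) =
      ∑ i, ∑ j, a i * b j * freeCovarianceReal m (f i) (f j) := by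
  have hG := h.1
  rw [← IsFreeField.twoPoint_eq_holds h]
  unfold twoPoint
  have e : (fun ω : FieldConfig E => ω (∑ i, a i • f i) * ω (∑ j, b j • f j)) =
      fun ω => ∑ i, ∑ j, a i * b j * (ω (f i) * ω (f j)) := by
    funext ω
    simp only [map_sum, map_smul, smul_eq_mul]
    rw [Finset.sum_mul]
    refine Finset.sum_congr rfl fun i _ => ?_
    rw [Finset.mul_sum]
    refine Finset.sum_congr rfl fun j _ => ?_
    ring
  rw [e, integral_finsetSum _ fun i _ => ?_]
  · refine Finset.sum_congr rfl fun i _ => ?_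
    rw [integral_finsetSum _ fun j _ => ?_]
    · refine Finset.sum_congr rfl fun j _ => ?_
      rw [integral_const_mul, ← IsFreeField.twoPoint_eq_holds h]
      rfl
    · exact (hG.integrable_eval_mul _ _).const_mul _
  · exact integrable_finsetSum _ fun j _ => (hG.integrable_eval_mul _ _).const_mul _

/-- **OS0 for the free field, closed form** (Glimm–Jaffe §6.1 OS0; §6.2 (6.2.2)–(6.2.4)): for real
test functions `f₁, …, fₙ` and `z ∈ ℂⁿ`,
`∫ exp (i ∑ᵢ zᵢ ω(fᵢ)) dμ_m(ω) = exp (-½ ∑ᵢⱼ zᵢ zⱼ C_m(fᵢ, fⱼ))`. Reduced to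
`IsFreeField.integral_cexp_eval_sub_eval` with `g = ∑ (re zᵢ) fᵢ`, `k = ∑ (im zᵢ) fᵢ`.
[cite: GlimmJaffeQP1987, §6.2 eq. (6.2.2)] -/
theorem _root_.Literature.MathematicalPhysics.QuantumLattice.IsFreeField.integral_cexp_sum_eq
    {m : ℝ} {μ : Measure (FieldConfig E)} (h : IsFreeField m μ) {n : ℕ}
    (f : Fin n → 𝓢(E, ℝ)) (z : Fin n → ℂ) :
    ∫ ω, cexp (I * ∑ i, z i * (ω (f i) : ℂ)) ∂μ =
      cexp (-(1 / 2 : ℂ) * ∑ i, ∑ j, z i * z j * (freeCovarianceReal m (f i) (f j) : ℂ)) := by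
  -- real and imaginary parts of the complex test function `∑ zᵢ fᵢ`
  have hz : ∀ i, z i = ((z i).re : ℂ) + ((z i).im : ℂ) * I := fun i => (Complex.re_add_im (z i)).symm
  have hg : ∀ ω : FieldConfig E, (ω (∑ i, (z i).re • f i) : ℝ) = ∑ i, (z i).re * ω (f i) :=
    fun ω => by simp only [map_sum, map_smul, smul_eq_mul]
  have hk : ∀ ω : FieldConfig E, (ω (∑ i, (z i).im • f i) : ℝ) = ∑ i, (z i).im * ω (f i) :=
    fun ω => by simp only [map_sum, map_smul, smul_eq_mul]
  have hsum : ∀ ω : FieldConfig E, I * ∑ i, z i * (ω (f i) : ℂ) =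
      I * (ω (∑ i, (z i).re • f i) : ℂ) - (ω (∑ i, (z i).im • f i) : ℂ) := by
    intro ω
    rw [hg, hk]
    push_cast
    rw [Finset.mul_sum, Finset.mul_sum, ← Finset.sum_sub_distrib]
    refine Finset.sum_congr rfl fun i _ => ?_
    linear_combination (I * (ω (f i) : ℂ)) * hz i +
      ((z i).im : ℂ) * (ω (f i) : ℂ) * Complex.I_sq
  have e1 : (fun ω : FieldConfig E => cexp (I * ∑ i, z i * (ω (f i) : ℂ))) =
      fun ω => cexp (I * (ω (∑ i, (z i).re • f i) : ℂ) - (ω (∑ i, (z i).im • f i) : ℂ)) :=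
    funext fun ω => by rw [hsum]
  rw [e1, h.integral_cexp_eval_sub_eval, h.freeCovarianceReal_sum_smul f,
    h.freeCovarianceReal_sum_smul f, h.freeCovarianceReal_sum_smul f]
  congr 1
  -- the exponent: `-½ (S(a,a) - S(b,b)) - i S(a,b) = -½ ∑ zᵢ zⱼ Cᵢⱼ` with `z = a + ib`
  set C : Fin n → Fin n → ℝ := fun i j => freeCovarianceReal m (f i) (f j) with hC
  have hCsymm : ∀ i j, C i j = C j i := fun i j => freeCovarianceReal_comm m (f i) (f j)
  have hzz : ∀ i j, z i * z j =
      (((z i).re * (z j).re - (z i).im * (z j).im : ℝ) : ℂ) +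
        (((z i).re * (z j).im + (z i).im * (z j).re : ℝ) : ℂ) * I := fun i j =>
    Complex.ext (by simp [Complex.mul_re]) (by simp [Complex.mul_im])
  have key : ∑ i, ∑ j, z i * z j * (C i j : ℂ) =
      (∑ i, ∑ j, (((z i).re * (z j).re * C i j : ℝ) : ℂ)) -
        (∑ i, ∑ j, (((z i).im * (z j).im * C i j : ℝ) : ℂ)) +
        I * ((∑ i, ∑ j, (((z i).re * (z j).im * C i j : ℝ) : ℂ)) +
          ∑ i, ∑ j, (((z i).im * (z j).re * C i j : ℝ) : ℂ)) := by
    have hterm : ∀ i j, z i * z j * (C i j : ℂ) =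
        (((z i).re * (z j).re * C i j : ℝ) : ℂ) - (((z i).im * (z j).im * C i j : ℝ) : ℂ) +
          I * ((((z i).re * (z j).im * C i j : ℝ) : ℂ) +
            (((z i).im * (z j).re * C i j : ℝ) : ℂ)) := by
      intro i j
      rw [hzz]
      push_cast
      ring
    simp_rw [hterm, Finset.sum_add_distrib, Finset.sum_sub_distrib, ← Finset.mul_sum,
      Finset.sum_add_distrib]
  have hsym : ∑ i, ∑ j, (((z i).im * (z j).re * C i j : ℝ) : ℂ) =
      ∑ i, ∑ j, (((z i).re * (z j).im * C i j : ℝ) : ℂ) := by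
    rw [Finset.sum_comm]
    refine Finset.sum_congr rfl fun i _ => Finset.sum_congr rfl fun j _ => ?_
    rw [hCsymm j i]
    push_cast
    ring
  rw [key, hsym]
  push_cast
  ring

/-- **OS0 (analyticity) for the free field** (Glimm–Jaffe §6.1, axiom OS0, p. 89: "the functional
`S{f}` is entire analytic ... `z ↦ S{∑ zⱼ fⱼ}` is entire on `ℂᴺ`. In other words, `dμ` decays
faster than any exponential"; for the Gaussian measure `dφ_C` this is (6.2.2)). The free field has
exponential moments and `z ↦ ∫ exp (i ∑ zᵢ ω(fᵢ)) dμ_m = exp (-½ ∑ zᵢ zⱼ C_m(fᵢ, fⱼ))` is the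
exponential of a polynomial, hence entire on `ℂⁿ`. [cite: GlimmJaffeQP1987, §6.1 OS0; §6.2 eq. (6.2.2)] -/
theorem _root_.Literature.MathematicalPhysics.QuantumLattice.IsFreeField.isOS0Analytic
    {m : ℝ} {μ : Measure (FieldConfig E)} (h : IsFreeField m μ) : IsOS0Analytic μ := by
  refine ⟨h.1.hasExponentialMoments, fun n f => ?_⟩
  have e : (fun z : Fin n → ℂ => ∫ ω, cexp (I * ∑ i, z i * (ω (f i) : ℂ)) ∂μ) =
      fun z => cexp (-(1 / 2 : ℂ) *
        ∑ i, ∑ j, z i * z j * (freeCovarianceReal m (f i) (f j) : ℂ)) :=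
    funext fun z => h.integral_cexp_sum_eq f z
  rw [e]
  refine AnalyticOnNhd.cexp (analyticOnNhd_const.mul
    (Finset.analyticOnNhd_fun_sum _ fun i _ => Finset.analyticOnNhd_fun_sum _ fun j _ => ?_))
  exact (((ContinuousLinearMap.proj (R := ℂ) (φ := fun _ : Fin n => ℂ) i).analyticOnNhd _).mul
    ((ContinuousLinearMap.proj (R := ℂ) (φ := fun _ : Fin n => ℂ) j).analyticOnNhd _)).mul
    analyticOnNhd_const

end ComplexGaussian

/-! ### OS2: Euclidean invariance -/

section Invariance

variable {E : Type*} [NormedAddCommGroup E] [InnerProductSpace ℝ E] [FiniteDimensional ℝ E]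
  [MeasurableSpace E] [BorelSpace E]

/-- The generating functional of the image of a law under the transpose of a continuous linear
map `T` on test functions: `S_{Tᵗμ}(f) = S_μ(T f)`. Glimm–Jaffe §6.1 (OS2: "`E` acts on `𝒟'`
via `(Eφ)(f) = φ(Ef)`"). [folklore] -/
theorem genFunctional_map_act {V : Type*} [NormedAddCommGroup V] [NormedSpace ℝ V]
    (μ : Measure (FieldConfig V)) (T : 𝓢(V, ℝ) →L[ℝ] 𝓢(V, ℝ)) (f : 𝓢(V, ℝ)) :
    genFunctional (μ.map (FieldConfig.act T)) f = genFunctional μ (T f) := by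
  unfold genFunctional
  rw [integral_map (FieldConfig.measurable_act T).aemeasurable]
  · rfl
  · exact (Continuous.aestronglyMeasurable (by fun_prop))

/-- **OS2 (Euclidean invariance) for the free field** (Glimm–Jaffe §6.1 OS2, p. 90: "`S{f}` is
invariant under Euclidean symmetries ... Equivalently `dμ` is Euclidean invariant"; §6.2 p. 99:
"`dφ_C` and `S` satisfy ... Euclidean invariance if and only if `C` does"; §7.1: `C = (-Δ + m²)⁻¹`
is Euclidean invariant). For every Euclidean motion `γ`, `γ_* μ_m` is a finite measure with the
same generating functional `exp (-½ C_m(γ⁻¹f, γ⁻¹f)) = exp (-½ C_m(f, f))`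
(`freeCovarianceReal_euclidAct` over the discharged facts `freeCovariance_translate_holds`,
`freeCovariance_linAct_holds`), hence equals `μ_m` (`ext_of_genFunctional_holds`).
[cite: GlimmJaffeQP1987, §6.1 OS2; §6.2 p. 99] -/
theorem _root_.Literature.MathematicalPhysics.QuantumLattice.IsFreeField.isOS2Invariant
    {m : ℝ} {μ : Measure (FieldConfig E)} (h : IsFreeField m μ) : IsOS2Invariant μ := by
  intro γ
  haveI : IsGaussian μ := h.1.1
  refine ext_of_genFunctional_holds (funext fun f => ?_)
  rw [euclidActField, genFunctional_map_act, h.2, h.2,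
    freeCovarianceReal_euclidAct freeCovariance_translate_holds freeCovariance_linAct_holds]

end Invariance

end Literature.MathematicalPhysics.QuantumFieldTheory
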